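import Mathlib
import HarnessLib

/-!
# Non-asymptotic bias and MSE of the autonormalized importance sampling estimator (Agapiou–Papaspiliopoulos–Sanz-Alonso–Stuart 2017, Theorem 2.1)

Topic `Literature/Probability/ImportanceSampling`.  Source [AgapiouEtAl2017]: S. Agapiou, O. Papaspiliopoulos,
D. Sanz-Alonso, A. M. Stuart, *Importance Sampling: Intrinsic Dimension and Computational Cost*, Statist. Sci. 32
(2017) 405–431, doi:10.1214/17-sts611 = e-print arXiv:1511.06196 ("Importance Sampling: Computational Complexity and
Intrinsic Dimension"; held LaTeX text, whose section numbering is used below).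

VERBATIM §2.1 "General Setting": "We consider target µ and proposal π, both probability measures on the measurable
space (X, F), related by (1.1) [dµ/dπ ∝ g]. … For a test function φ : X → ℝ such that µ(|φ|) < ∞, the identity
µ(φ) = π(φg)/π(g), leads to the autonormalized importance sampling estimator:
µ^N(φ) := (1/N Σ_{n=1}^N φ(u^n)g(u^n)) / (1/N Σ_{m=1}^N g(u^m)), u^n ∼ π i.i.d. = Σ_{n=1}^N w^n φ(u^n),
w^n := g(u^n)/Σ_{m=1}^N g(u^m); here the w^n's are called the normalized weights."
§2.2 "A Non-asymptotic Bound on Particle Approximation Error": "A fundamental quantity in addressing this issue is ρ,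
defined by ρ := π(g²)/π(g)². Thus ρ is the second moment of the Radon-Nikodym derivative of the target with respect to
the proposal. The Cauchy-Schwarz inequality shows that π(g)² ≤ π(g²) and hence that ρ ≥ 1. Our first non-asymptotic
result shows that, for bounded test functions φ, both the bias and the mean square error (MSE) of the autonormalized
importance sampling estimator are O(N^{−1}) with constant of proportionality linear in ρ.
**Theorem 2.1.** Assume that µ is absolutely continuous with respect to π, with square-integrable density g, that is,
π(g²) < ∞. The bias and MSE of importance sampling over bounded test functions may be characterized as follows:
  sup_{|φ|≤1} |E[µ^N(φ) − µ(φ)]| ≤ (12/N) ρ,   and   sup_{|φ|≤1} E[(µ^N(φ) − µ(φ))²] ≤ (4/N) ρ.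
**Remark 2.2.** For a bounded test function |φ| ≤ 1, we trivially get |µ^N(φ) − µ(φ)| ≤ 2; hence the bounds on bias
and MSE provided in Theorem 2.1 are useful only when they are smaller than 2 and 4, respectively."
§6.3.1 "Proof of Theorem 2.1" (VERBATIM skeleton, followed below): bias — "µ^N(φ) − µ(φ) = (1/π^N_MC(g)) π^N_MC(φ̄ g)",
φ̄ := φ − µ(φ), "π(φ̄ g) = 0", "E[µ^N(φ) − µ(φ)] = E[(1/(π^N_MC(g) π(g))) (π(g) − π^N_MC(g)) (π^N_MC(φ̄g) − π(φ̄g))]",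
split on the event {2π^N_MC(g) > π(g)}: "≤ (2/π(g)²) E[|π(g) − π^N_MC(g)| |π^N_MC(φ̄g) − π(φ̄g)|] + 2 P(2π^N_MC(g) ≤ π(g))
≤ (2/π(g)²) (1/√N) π(g²)^{1/2} (2/√N) π(g²)^{1/2} + 2 P(2π^N_MC(g) ≤ π(g))", "By the Markov inequality
P(2π^N_MC(g) ≤ π(g)) ≤ (4/N) π(g²)/π(g)²"; MSE — "µ^N(φ) − µ(φ) = (1/π(g))(π(g) − π^N_MC(g)) µ^N(φ) − (1/π(g))(π(φg) −
π^N_MC(φg)), and so using the inequality (a + b)² ≤ 2(a² + b²) … E[(µ^N(φ) − µ(φ))²] ≤ (2/π(g)²){Var_π(π^N_MC(g)) +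
Var_π(π^N_MC(φg))} ≤ (2/(Nπ(g)²)){π(g²) + π(φ²g²)} ≤ (4/N) π(g²)/π(g)²".

What is here (all PROVED, Mathlib only; no named facts).  Setting: a probability measure `π` on a measurable space
`𝓧`, a measurable weight `g ≥ 0` with `π(g²) < ∞` (`MemLp g 2 π`) and `π(g) > 0`, a measurable test function `φ` with
`|φ| ≤ 1`; the `N` i.i.d. draws are realised canonically on `(Fin N → 𝓧, π^{⊗N})` (`Measure.pi`), as in the sibling file
`ChatterjeeDiaconis.lean`.
* `Autonormalized.estimate g φ N u` — `µ^N(φ) = Σ_n φ(u^n)g(u^n) / Σ_m g(u^m)` (§2.1; Lean's `x/0 = 0` for a sample with all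
  weights zero, a `π^{⊗N}`-null event whenever `π(g = 0) < 1` is not assumed — the bounds below hold regardless);
* `Autonormalized.targetMean π g φ` — `µ(φ) = π(φg)/π(g)` (§2.1); `Autonormalized.rho π g` — `ρ = π(g²)/π(g)²` (§2.2);
* `Autonormalized.abs_estimate_le_one`, `abs_targetMean_le_one`, `abs_estimate_sub_targetMean_le_two` — Remark 2.2's
  "we trivially get |µ^N(φ) − µ(φ)| ≤ 2";
* `Autonormalized.one_le_rho` — "ρ ≥ 1" (§2.2, Cauchy–Schwarz);
* **`Autonormalized.mse_le`** — Theorem 2.1, MSE: `E[(µ^N(φ) − µ(φ))²] ≤ (4/N) ρ` for every `|φ| ≤ 1`, `N ≥ 1`;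
* **`Autonormalized.abs_bias_le`** — Theorem 2.1, bias: `|E[µ^N(φ) − µ(φ)]| ≤ (12/N) ρ` for every `|φ| ≤ 1`, `N ≥ 1`.
The proofs follow §6.3.1 step by step; the one deviation is cosmetic: the Cauchy–Schwarz step
"E|π(g) − π^N_MC(g)| |π^N_MC(φ̄g)| ≤ (π(g²)/N)^{1/2} (4π(g²)/N)^{1/2}" is replaced by the pointwise AM–GM bound
`|x||y| ≤ x² + y²/4`, which yields the same constant.  The finite-population identities of §2.3 (D_{χ²} = ρ − 1,
ρ ≥ e^{D_KL}, ESS) are typed in `OptimalImportanceDistribution.lean` (section `Divergences`), where ρ is identified with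
the lane quantity "headroom" H.  (Filed by the pub-qed literature seat gen 24 for `irse/IDEAS-sampler.md` card S8, whose
KL̂ / mass-profile / share readers are "self-normalised importance-sampling estimators of functionals of q* with proposal q
and weights |w| … bias O(1/N)": for a bounded functional the printed constants are 12H/N (bias) and 4H/N (MSE);
VALUE-FREE; independent recomputation; certified where stated, statistical where stated; no new-physics claim.)

## References
* [AgapiouEtAl2017] S. Agapiou, O. Papaspiliopoulos, D. Sanz-Alonso, A. M. Stuart, *Importance Sampling: Intrinsic
  Dimension and Computational Cost*, Statistical Science 32 (2017) 405–431, doi:10.1214/17-sts611, arXiv:1511.06196 —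
  §2.1, §2.2 Theorem 2.1, Remark 2.2, §6.3.1 (proof of Theorem 2.1).
-/

namespace Literature.Probability.ImportanceSampling

namespace Autonormalized

open _root_.MeasureTheory _root_.ProbabilityTheory Finset

variable {𝓧 : Type*} [MeasurableSpace 𝓧]

section Definitions

/-- The autonormalized importance sampling estimator `µ^N(φ)(u) = Σ_n φ(u^n) g(u^n) / Σ_m g(u^m)`
`= Σ_n w^n φ(u^n)`, `w^n = g(u^n)/Σ_m g(u^m)`, computed from an `N`-sample `u : Fin N → 𝓧`
[cite: AgapiouEtAl2017, §2.1 (display defining µ^N(φ))]. (`0` when all weights vanish, by Lean's `x/0 = 0`.) -/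
noncomputable def estimate (g φ : 𝓧 → ℝ) (N : ℕ) (u : Fin N → 𝓧) : ℝ :=
  (∑ n, φ (u n) * g (u n)) / ∑ n, g (u n)

omit [MeasurableSpace 𝓧] in
/-- Unfolding lemma for `estimate` [cite: AgapiouEtAl2017, §2.1]. -/
theorem estimate_def (g φ : 𝓧 → ℝ) (N : ℕ) (u : Fin N → 𝓧) :
    estimate g φ N u = (∑ n, φ (u n) * g (u n)) / ∑ n, g (u n) := rfl

/-- The target expectation `µ(φ) = π(φg)/π(g)` [cite: AgapiouEtAl2017, §2.1 (display µ(φ) = π(φg)/π(g))]. -/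
noncomputable def targetMean (π : Measure 𝓧) (g φ : 𝓧 → ℝ) : ℝ :=
  (∫ x, φ x * g x ∂π) / ∫ x, g x ∂π

/-- Unfolding lemma for `targetMean` [cite: AgapiouEtAl2017, §2.1]. -/
theorem targetMean_def (π : Measure 𝓧) (g φ : 𝓧 → ℝ) :
    targetMean π g φ = (∫ x, φ x * g x ∂π) / ∫ x, g x ∂π := rfl

/-- `ρ := π(g²)/π(g)²`, "the second moment of the Radon-Nikodym derivative of the target with respect to the proposal"
[cite: AgapiouEtAl2017, §2.2 (display defining ρ)]. -/
noncomputable def rho (π : Measure 𝓧) (g : 𝓧 → ℝ) : ℝ :=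
  (∫ x, g x ^ 2 ∂π) / (∫ x, g x ∂π) ^ 2

/-- Unfolding lemma for `rho` [cite: AgapiouEtAl2017, §2.2]. -/
theorem rho_def (π : Measure 𝓧) (g : 𝓧 → ℝ) : rho π g = (∫ x, g x ^ 2 ∂π) / (∫ x, g x ∂π) ^ 2 := rfl

end Definitions

section Elementary

variable {g φ : 𝓧 → ℝ}

omit [MeasurableSpace 𝓧] in
/-- `|Σ_n φ(u^n) g(u^n)| ≤ Σ_n g(u^n)` for `|φ| ≤ 1`, `g ≥ 0` [folklore]. -/
private theorem abs_sum_mul_le (hg0 : ∀ x, 0 ≤ g x) (hφ1 : ∀ x, |φ x| ≤ 1) {N : ℕ} (u : Fin N → 𝓧) :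
    |∑ n, φ (u n) * g (u n)| ≤ ∑ n, g (u n) := by
  refine le_trans (abs_sum_le_sum_abs _ _) (sum_le_sum fun n _ => ?_)
  rw [abs_mul, abs_of_nonneg (hg0 (u n))]
  calc |φ (u n)| * g (u n) ≤ 1 * g (u n) := mul_le_mul_of_nonneg_right (hφ1 (u n)) (hg0 (u n))
    _ = g (u n) := one_mul _

omit [MeasurableSpace 𝓧] in
/-- **Remark 2.2, first half**: `|µ^N(φ)| ≤ 1` for `|φ| ≤ 1` (and `g ≥ 0`) — the estimator is a convex combination of
values of `φ` [cite: AgapiouEtAl2017, Remark 2.2]. -/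
theorem abs_estimate_le_one (hg0 : ∀ x, 0 ≤ g x) (hφ1 : ∀ x, |φ x| ≤ 1) {N : ℕ} (u : Fin N → 𝓧) :
    |estimate g φ N u| ≤ 1 := by
  unfold estimate
  have hden : 0 ≤ ∑ n, g (u n) := sum_nonneg fun n _ => hg0 (u n)
  by_cases h0 : ∑ n, g (u n) = 0
  · rw [h0, div_zero, abs_zero]
    exact zero_le_one
  · rw [abs_div, abs_of_nonneg hden, div_le_one (lt_of_le_of_ne hden (Ne.symm h0))]
    exact abs_sum_mul_le hg0 hφ1 u

variable {π : Measure 𝓧} [IsProbabilityMeasure π]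

omit [IsProbabilityMeasure π] in
/-- `φg` is integrable for `|φ| ≤ 1` measurable and `g` integrable [folklore]. -/
private theorem integrable_mul (hφ : Measurable φ) (hφ1 : ∀ x, |φ x| ≤ 1) (hg : Integrable g π) :
    Integrable (fun x => φ x * g x) π :=
  hg.bdd_mul hφ.aestronglyMeasurable (Filter.Eventually.of_forall fun x => by
    rw [Real.norm_eq_abs]; exact hφ1 x)

omit [IsProbabilityMeasure π] in
/-- `|π(φg)| ≤ π(g)` for `|φ| ≤ 1`, `g ≥ 0` integrable [folklore]. -/
private theorem abs_integral_mul_le (hφ1 : ∀ x, |φ x| ≤ 1) (hg0 : ∀ x, 0 ≤ g x)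
    (hg : Integrable g π) : |∫ x, φ x * g x ∂π| ≤ ∫ x, g x ∂π := by
  refine le_trans abs_integral_le_integral_abs ?_
  refine integral_mono_of_nonneg (Filter.Eventually.of_forall fun x => abs_nonneg _) hg
    (Filter.Eventually.of_forall fun x => ?_)
  simp only
  rw [abs_mul, abs_of_nonneg (hg0 x)]
  calc |φ x| * g x ≤ 1 * g x := mul_le_mul_of_nonneg_right (hφ1 x) (hg0 x)
    _ = g x := one_mul _

omit [IsProbabilityMeasure π] in
/-- **Remark 2.2, second half**: `|µ(φ)| ≤ 1` for `|φ| ≤ 1`, `g ≥ 0` integrable [cite: AgapiouEtAl2017, Remark 2.2]. -/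
theorem abs_targetMean_le_one (hφ1 : ∀ x, |φ x| ≤ 1) (hg0 : ∀ x, 0 ≤ g x)
    (hg : Integrable g π) : |targetMean π g φ| ≤ 1 := by
  unfold targetMean
  have hden : 0 ≤ ∫ x, g x ∂π := integral_nonneg hg0
  by_cases h0 : ∫ x, g x ∂π = 0
  · rw [h0, div_zero, abs_zero]
    exact zero_le_one
  · rw [abs_div, abs_of_nonneg hden, div_le_one (lt_of_le_of_ne hden (Ne.symm h0))]
    exact abs_integral_mul_le hφ1 hg0 hg

omit [IsProbabilityMeasure π] in
/-- **Remark 2.2**: "For a bounded test function |φ| ≤ 1, we trivially get |µ^N(φ) − µ(φ)| ≤ 2"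
[cite: AgapiouEtAl2017, Remark 2.2]. -/
theorem abs_estimate_sub_targetMean_le_two (hφ1 : ∀ x, |φ x| ≤ 1) (hg0 : ∀ x, 0 ≤ g x)
    (hg : Integrable g π) {N : ℕ} (u : Fin N → 𝓧) :
    |estimate g φ N u - targetMean π g φ| ≤ 2 := by
  calc |estimate g φ N u - targetMean π g φ| ≤ |estimate g φ N u| + |targetMean π g φ| := abs_sub _ _
    _ ≤ 1 + 1 := add_le_add (abs_estimate_le_one hg0 hφ1 u) (abs_targetMean_le_one hφ1 hg0 hg)
    _ = 2 := by norm_num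

/-- **"ρ ≥ 1"**: "The Cauchy-Schwarz inequality shows that π(g)² ≤ π(g²) and hence that ρ ≥ 1" (`π` a probability
measure, `π(g²) < ∞`, `π(g) ≠ 0`) [cite: AgapiouEtAl2017, §2.2]. -/
theorem one_le_rho (hg2 : MemLp g 2 π) (hπg : ∫ x, g x ∂π ≠ 0) : 1 ≤ rho π g := by
  unfold rho
  have hvar : 0 ≤ variance g π := variance_nonneg g π
  rw [variance_eq_sub hg2] at hvar
  have hsq : (∫ x, g x ∂π) ^ 2 ≤ ∫ x, g x ^ 2 ∂π := by
    have : π[g ^ 2] = ∫ x, g x ^ 2 ∂π := rfl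
    linarith [hvar, this]
  rw [le_div_iff₀ (sq_pos_iff.mpr hπg), one_mul]
  exact hsq

end Elementary

section SampleMeans

/-! ### The i.i.d. sample on `(Fin N → 𝓧, π^{⊗N})`: empirical means `π^N_MC(h) = (1/N) Σ_n h(u^n)` -/

variable {π : Measure 𝓧} [IsProbabilityMeasure π]

/-- The empirical (Monte Carlo) mean `π^N_MC(h)(u) = (1/N) Σ_n h(u^n)` [cite: AgapiouEtAl2017, §2.3.2 (π^N_MC)]. -/
noncomputable def mcMean (h : 𝓧 → ℝ) (N : ℕ) (u : Fin N → 𝓧) : ℝ := (1 / (N : ℝ)) * ∑ n, h (u n)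

omit [MeasurableSpace 𝓧] in
/-- Unfolding lemma for `mcMean` [cite: AgapiouEtAl2017, §2.3.2]. -/
theorem mcMean_def (h : 𝓧 → ℝ) (N : ℕ) (u : Fin N → 𝓧) : mcMean h N u = (1 / (N : ℝ)) * ∑ n, h (u n) := rfl

omit [MeasurableSpace 𝓧] in
/-- `µ^N(φ) = π^N_MC(φg)/π^N_MC(g)` [cite: AgapiouEtAl2017, §2.1 (first form of the estimator)]. -/
theorem estimate_eq_mcMean_div {g φ : 𝓧 → ℝ} {N : ℕ} (hN : (N : ℝ) ≠ 0) (u : Fin N → 𝓧) :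
    estimate g φ N u = mcMean (fun x => φ x * g x) N u / mcMean g N u := by
  unfold estimate mcMean
  rw [mul_div_mul_left _ _ (one_div_ne_zero hN)]

/-- measurability of an empirical mean [folklore] -/
private theorem measurable_mcMean {h : 𝓧 → ℝ} (hh : Measurable h) (N : ℕ) : Measurable (mcMean h N) := by
  unfold mcMean
  refine Measurable.const_mul ?_ _
  refine Finset.measurable_sum _ fun n _ => ?_
  exact hh.comp (measurable_pi_apply n)

/-- marginal integral: `∫ h(u n) dπ^{⊗N} = ∫ h dπ` [folklore] -/
private theorem integral_eval (N : ℕ) (n : Fin N) {h : 𝓧 → ℝ} (hh : AEStronglyMeasurable h π) :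
    ∫ u, h (u n) ∂(Measure.pi (fun _ : Fin N => π)) = ∫ x, h x ∂π := by
  have hmp := measurePreserving_eval (fun _ : Fin N => π) n
  have h1 : ∫ y, h y ∂((Measure.pi (fun _ : Fin N => π)).map (Function.eval n)) =
      ∫ u, h (Function.eval n u) ∂(Measure.pi (fun _ : Fin N => π)) := by
    apply integral_map (measurable_pi_apply n).aemeasurable
    rw [hmp.map_eq]
    exact hh
  rw [hmp.map_eq] at h1
  rw [h1]

/-- `π^N_MC(h) ∈ L²(π^{⊗N})` for `h ∈ L²(π)` [folklore] -/
private theorem memLp_mcMean {h : 𝓧 → ℝ} (hh : MemLp h 2 π) (N : ℕ) :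
    MemLp (mcMean h N) 2 (Measure.pi (fun _ : Fin N => π)) := by
  have hY : ∀ n : Fin N, MemLp (fun u : Fin N → 𝓧 => h (u n)) 2 (Measure.pi (fun _ : Fin N => π)) :=
    fun n => hh.comp_measurePreserving (measurePreserving_eval (fun _ : Fin N => π) n)
  have hS : MemLp (fun u : Fin N → 𝓧 => ∑ n, h (u n)) 2 (Measure.pi (fun _ : Fin N => π)) :=
    memLp_finsetSum (Finset.univ : Finset (Fin N)) (fun n _ => hY n)
  exact hS.const_mul (1 / (N : ℝ))

/-- `E[π^N_MC(h)] = π(h)` for `N ≥ 1` [folklore] -/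
private theorem integral_mcMean {h : 𝓧 → ℝ} (hh : MemLp h 2 π) {N : ℕ} (hN : (N : ℝ) ≠ 0) :
    ∫ u, mcMean h N u ∂(Measure.pi (fun _ : Fin N => π)) = ∫ x, h x ∂π := by
  have hint : Integrable h π := hh.integrable one_le_two
  have hY : ∀ n : Fin N, Integrable (fun u : Fin N → 𝓧 => h (u n)) (Measure.pi (fun _ : Fin N => π)) :=
    fun n => (hh.comp_measurePreserving (measurePreserving_eval (fun _ : Fin N => π) n)).integrable one_le_two
  unfold mcMean
  rw [integral_const_mul, integral_finsetSum _ (fun n _ => hY n)]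
  simp only [integral_eval N _ hint.aestronglyMeasurable, Finset.sum_const, Finset.card_univ, Fintype.card_fin,
    nsmul_eq_mul]
  field_simp

/-- **Variance of the i.i.d. mean**: `E[(π^N_MC(h) − π(h))²] = Var_π(h)/N ≤ π(h²)/N` (`N ≥ 1`) — the step
"Var_π(π^N_MC(g)) ≤ π(g²)/N" of the printed proof [cite: AgapiouEtAl2017, §6.3.1 (proof of Theorem 2.1)]. -/
theorem integral_sq_mcMean_sub_le {h : 𝓧 → ℝ} (hh : MemLp h 2 π) {N : ℕ} (hN : (N : ℝ) ≠ 0) :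
    ∫ u, (mcMean h N u - ∫ x, h x ∂π) ^ 2 ∂(Measure.pi (fun _ : Fin N => π)) ≤ (∫ x, h x ^ 2 ∂π) / N := by
  set P := Measure.pi (fun _ : Fin N => π) with hP
  have hm := memLp_mcMean hh N
  -- ∫ (M − E M)² = Var[M]
  have h1 : ∫ u, (mcMean h N u - ∫ x, h x ∂π) ^ 2 ∂P = variance (mcMean h N) P := by
    rw [variance_eq_integral hm.aemeasurable, integral_mcMean hh hN]
  -- Var[M] = (1/N)² Var[S] = (1/N)² · N · Var[h]
  have h2 : variance (mcMean h N) P = (1 / (N : ℝ)) ^ 2 * (N * variance h π) := by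
    have hS : variance (fun u : Fin N → 𝓧 => ∑ n, h (u n)) P = N * variance h π := by
      have := variance_sum_pi (μ := fun _ : Fin N => π) (X := fun _ : Fin N => h) (fun _ => hh)
      have hfun : (∑ n : Fin N, fun u : Fin N → 𝓧 => h (u n)) = fun u => ∑ n, h (u n) := by
        funext u
        simp only [Finset.sum_apply]
      rw [hfun] at this
      rw [hP, this]
      simp
    unfold mcMean
    rw [variance_const_mul, hS]
  have h3 : variance h π ≤ ∫ x, h x ^ 2 ∂π := by
    have := variance_le_expectation_sq (μ := π) hh.aestronglyMeasurable
    exact this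
  rw [h1, h2]
  have hNpos : 0 < (N : ℝ) := lt_of_le_of_ne (Nat.cast_nonneg N) (Ne.symm hN)
  calc (1 / (N : ℝ)) ^ 2 * (N * variance h π) = variance h π / N := by field_simp
    _ ≤ (∫ x, h x ^ 2 ∂π) / N := div_le_div_of_nonneg_right h3 hNpos.le

/-- **Chebyshev for the i.i.d. mean**: `P(c ≤ |π^N_MC(h) − π(h)|) ≤ π(h²)/(N c²)` (`N ≥ 1`, `c > 0`) — the step
"By the Markov inequality P(2π^N_MC(g) ≤ π(g)) ≤ (4/N) π(g²)/π(g)²" of the printed proof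
[cite: AgapiouEtAl2017, §6.3.1 (proof of Theorem 2.1)]. -/
theorem measureReal_le_abs_mcMean_sub_le {h : 𝓧 → ℝ} (hh : MemLp h 2 π) {N : ℕ} (hN : (N : ℝ) ≠ 0)
    {c : ℝ} (hc : 0 < c) :
    (Measure.pi (fun _ : Fin N => π)).real {u | c ≤ |mcMean h N u - ∫ x, h x ∂π|}
      ≤ (∫ x, h x ^ 2 ∂π) / (N * c ^ 2) := by
  set P := Measure.pi (fun _ : Fin N => π) with hP
  have hm := memLp_mcMean hh N
  have hcheb := meas_ge_le_variance_div_sq hm hc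
  rw [integral_mcMean hh hN] at hcheb
  have hvar : variance (mcMean h N) P ≤ (∫ x, h x ^ 2 ∂π) / N := by
    rw [variance_eq_integral hm.aemeasurable, integral_mcMean hh hN]
    exact integral_sq_mcMean_sub_le hh hN
  have hNpos : 0 < (N : ℝ) := lt_of_le_of_ne (Nat.cast_nonneg N) (Ne.symm hN)
  calc P.real {u | c ≤ |mcMean h N u - ∫ x, h x ∂π|}
      ≤ (ENNReal.ofReal (variance (mcMean h N) P / c ^ 2)).toReal := by
        rw [Measure.real]
        exact ENNReal.toReal_mono ENNReal.ofReal_ne_top hcheb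
    _ = variance (mcMean h N) P / c ^ 2 := ENNReal.toReal_ofReal (div_nonneg (variance_nonneg _ _) (sq_nonneg _))
    _ ≤ ((∫ x, h x ^ 2 ∂π) / N) / c ^ 2 := div_le_div_of_nonneg_right hvar (sq_nonneg _)
    _ = (∫ x, h x ^ 2 ∂π) / (N * c ^ 2) := by rw [div_div]

end SampleMeans

section Theorem21

variable {π : Measure 𝓧} [IsProbabilityMeasure π] {g φ : 𝓧 → ℝ} {N : ℕ}

omit [MeasurableSpace 𝓧] [IsProbabilityMeasure π] in
/-- `π^N_MC(g) = 0` forces `π^N_MC(φg) = 0` (all weights vanish; `g ≥ 0`) [folklore] -/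
private theorem mcMean_mul_eq_zero (hg0 : ∀ x, 0 ≤ g x) (u : Fin N → 𝓧) (h0 : mcMean g N u = 0)
    (hN : (N : ℝ) ≠ 0) : mcMean (fun x => φ x * g x) N u = 0 := by
  unfold mcMean at h0 ⊢
  have hsum : ∑ n, g (u n) = 0 := by
    rcases mul_eq_zero.mp h0 with h | h
    · exact absurd h (one_div_ne_zero hN)
    · exact h
  have hall := (Finset.sum_eq_zero_iff_of_nonneg fun n (_ : n ∈ Finset.univ) => hg0 (u n)).mp hsum
  rw [Finset.sum_eq_zero fun n hn => by simp only [hall n hn, mul_zero], mul_zero]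

omit [MeasurableSpace 𝓧] [IsProbabilityMeasure π] in
/-- `|π^N_MC(φg)| ≤ π^N_MC(g)` for `|φ| ≤ 1`, `g ≥ 0` [folklore] -/
private theorem abs_mcMean_mul_le (hg0 : ∀ x, 0 ≤ g x) (hφ1 : ∀ x, |φ x| ≤ 1) (u : Fin N → 𝓧) :
    |mcMean (fun x => φ x * g x) N u| ≤ mcMean g N u := by
  unfold mcMean
  rw [abs_mul, abs_of_nonneg (by positivity : (0 : ℝ) ≤ 1 / N)]
  exact mul_le_mul_of_nonneg_left (abs_sum_mul_le hg0 hφ1 u) (by positivity)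

omit [IsProbabilityMeasure π] in
/-- **The MSE decomposition of the printed proof**: `µ^N(φ) − µ(φ) = (1/π(g))(π(g) − π^N_MC(g)) µ^N(φ)
− (1/π(g))(π(φg) − π^N_MC(φg))` (valid also on the null event `π^N_MC(g) = 0` with Lean's conventions)
[cite: AgapiouEtAl2017, §6.3.1 (proof of Theorem 2.1, MSE part, first display)]. -/
theorem estimate_sub_targetMean_eq (hg0 : ∀ x, 0 ≤ g x) (hN : (N : ℝ) ≠ 0) (hπg : ∫ x, g x ∂π ≠ 0)
    (u : Fin N → 𝓧) :
    estimate g φ N u - targetMean π g φ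
      = (1 / ∫ x, g x ∂π) * ((∫ x, g x ∂π) - mcMean g N u) * estimate g φ N u
        - (1 / ∫ x, g x ∂π) * ((∫ x, φ x * g x ∂π) - mcMean (fun x => φ x * g x) N u) := by
  rw [estimate_eq_mcMean_div hN]
  unfold targetMean
  set a := ∫ x, g x ∂π
  set b := ∫ x, φ x * g x ∂π
  set S := mcMean g N u with hS
  set T := mcMean (fun x => φ x * g x) N u with hT
  by_cases hS0 : S = 0
  · have hT0 : T = 0 := mcMean_mul_eq_zero hg0 u hS0 hN
    rw [hS0, hT0]
    field_simp
    ring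
  · field_simp
    ring

/-- **Theorem 2.1 (Agapiou–Papaspiliopoulos–Sanz-Alonso–Stuart), MSE part**: for a probability measure `π`, a
measurable weight `g ≥ 0` with `π(g²) < ∞` and `π(g) > 0`, every measurable test function `|φ| ≤ 1` and every `N ≥ 1`,
`E[(µ^N(φ) − µ(φ))²] ≤ (4/N) ρ`, the expectation being over `u^1, …, u^N ∼ π` i.i.d. (`π^{⊗N}` on `Fin N → 𝓧`)
[cite: AgapiouEtAl2017, Theorem 2.1 (second display)]. -/
theorem mse_le (hg : Measurable g) (hg0 : ∀ x, 0 ≤ g x) (hg2 : MemLp g 2 π) (hπg : 0 < ∫ x, g x ∂π)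
    (hφ : Measurable φ) (hφ1 : ∀ x, |φ x| ≤ 1) (hN : 0 < N) :
    ∫ u, (estimate g φ N u - targetMean π g φ) ^ 2 ∂(Measure.pi (fun _ : Fin N => π))
      ≤ 4 / N * rho π g := by
  set P := Measure.pi (fun _ : Fin N => π) with hP
  have hN' : (N : ℝ) ≠ 0 := by exact_mod_cast hN.ne'
  have hNpos : (0 : ℝ) < N := by exact_mod_cast hN
  set a := ∫ x, g x ∂π with ha
  set b := ∫ x, φ x * g x ∂π with hb
  have ha0 : a ≠ 0 := hπg.ne'
  -- φg ∈ L²(π), dominated by g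
  have hφg2 : MemLp (fun x => φ x * g x) 2 π := by
    refine hg2.of_le (hφ.mul hg).aestronglyMeasurable (Filter.Eventually.of_forall fun x => ?_)
    rw [Real.norm_eq_abs, Real.norm_eq_abs, abs_mul]
    calc |φ x| * |g x| ≤ 1 * |g x| := mul_le_mul_of_nonneg_right (hφ1 x) (abs_nonneg _)
      _ = |g x| := one_mul _
  -- pointwise: E² ≤ (2/a²) [(a − S)² + (b − T)²]
  have hpt : ∀ u, (estimate g φ N u - targetMean π g φ) ^ 2
      ≤ 2 / a ^ 2 * ((mcMean g N u - a) ^ 2 + (mcMean (fun x => φ x * g x) N u - b) ^ 2) := by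
    intro u
    have hid := estimate_sub_targetMean_eq (π := π) (φ := φ) hg0 hN' ha0 u
    rw [← ha, ← hb] at hid
    have he : |estimate g φ N u| ≤ 1 := abs_estimate_le_one hg0 hφ1 u
    have he2 : estimate g φ N u ^ 2 ≤ 1 := by
      have := abs_le.mp he
      nlinarith [this.1, this.2]
    set E := estimate g φ N u
    set S := mcMean g N u
    set T := mcMean (fun x => φ x * g x) N u
    rw [hid]
    have hx2 : (1 / a * (a - S) * E) ^ 2 ≤ (1 / a * (a - S)) ^ 2 := by
      rw [mul_pow]
      exact mul_le_of_le_one_right (sq_nonneg _) he2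
    have hsum : (1 / a * (a - S) * E - 1 / a * (b - T)) ^ 2
        ≤ 2 * ((1 / a * (a - S) * E) ^ 2 + (1 / a * (b - T)) ^ 2) := by
      nlinarith [sq_nonneg (1 / a * (a - S) * E + 1 / a * (b - T))]
    calc (1 / a * (a - S) * E - 1 / a * (b - T)) ^ 2
        ≤ 2 * ((1 / a * (a - S)) ^ 2 + (1 / a * (b - T)) ^ 2) := by linarith [hsum, hx2]
      _ = 2 / a ^ 2 * ((S - a) ^ 2 + (T - b) ^ 2) := by
          field_simp
          ring
  -- integrate
  have hS2 := integral_sq_mcMean_sub_le (π := π) hg2 hN'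
  have hT2 := integral_sq_mcMean_sub_le (π := π) hφg2 hN'
  rw [← ha] at hS2
  rw [← hb] at hT2
  have hmS := memLp_mcMean (π := π) hg2 N
  have hmT := memLp_mcMean (π := π) hφg2 N
  have hiS : Integrable (fun u => (mcMean g N u - a) ^ 2) P := (hmS.sub (memLp_const a)).integrable_sq
  have hiT : Integrable (fun u => (mcMean (fun x => φ x * g x) N u - b) ^ 2) P :=
    (hmT.sub (memLp_const b)).integrable_sq
  have hint : Integrable (fun u => 2 / a ^ 2 *
      ((mcMean g N u - a) ^ 2 + (mcMean (fun x => φ x * g x) N u - b) ^ 2)) P :=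
    (hiS.add hiT).const_mul _
  have hφg_sq : ∫ x, (φ x * g x) ^ 2 ∂π ≤ ∫ x, g x ^ 2 ∂π := by
    refine integral_mono_of_nonneg (Filter.Eventually.of_forall fun x => sq_nonneg _) hg2.integrable_sq
      (Filter.Eventually.of_forall fun x => ?_)
    simp only
    rw [mul_pow]
    have h1 : φ x ^ 2 ≤ 1 := by
      have := abs_le.mp (hφ1 x)
      nlinarith [this.1, this.2]
    calc φ x ^ 2 * g x ^ 2 ≤ 1 * g x ^ 2 := mul_le_mul_of_nonneg_right h1 (sq_nonneg _)
      _ = g x ^ 2 := one_mul _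
  calc ∫ u, (estimate g φ N u - targetMean π g φ) ^ 2 ∂P
      ≤ ∫ u, 2 / a ^ 2 * ((mcMean g N u - a) ^ 2 + (mcMean (fun x => φ x * g x) N u - b) ^ 2) ∂P :=
        integral_mono_of_nonneg (Filter.Eventually.of_forall fun u => sq_nonneg _) hint
          (Filter.Eventually.of_forall hpt)
    _ = 2 / a ^ 2 * (∫ u, (mcMean g N u - a) ^ 2 ∂P + ∫ u, (mcMean (fun x => φ x * g x) N u - b) ^ 2 ∂P) := by
        rw [integral_const_mul, integral_add hiS hiT]
    _ ≤ 2 / a ^ 2 * ((∫ x, g x ^ 2 ∂π) / N + (∫ x, g x ^ 2 ∂π) / N) := by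
        refine mul_le_mul_of_nonneg_left (add_le_add hS2 (le_trans hT2 ?_)) (by positivity)
        exact div_le_div_of_nonneg_right hφg_sq hNpos.le
    _ = 4 / N * rho π g := by
        unfold rho
        rw [← ha]
        field_simp
        ring

/-- **Theorem 2.1 (Agapiou–Papaspiliopoulos–Sanz-Alonso–Stuart), bias part**: under the same hypotheses,
`|E[µ^N(φ) − µ(φ)]| ≤ (12/N) ρ` [cite: AgapiouEtAl2017, Theorem 2.1 (first display); §6.3.1 (proof)]. -/
theorem abs_bias_le (hg : Measurable g) (hg0 : ∀ x, 0 ≤ g x) (hg2 : MemLp g 2 π) (hπg : 0 < ∫ x, g x ∂π)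
    (hφ : Measurable φ) (hφ1 : ∀ x, |φ x| ≤ 1) (hN : 0 < N) :
    |∫ u, (estimate g φ N u - targetMean π g φ) ∂(Measure.pi (fun _ : Fin N => π))|
      ≤ 12 / N * rho π g := by
  set P := Measure.pi (fun _ : Fin N => π) with hP
  have hN' : (N : ℝ) ≠ 0 := by exact_mod_cast hN.ne'
  have hNpos : (0 : ℝ) < N := by exact_mod_cast hN
  set a := ∫ x, g x ∂π with ha
  set b := ∫ x, φ x * g x ∂π with hb
  have ha0 : a ≠ 0 := hπg.ne'
  have hgint : Integrable g π := hg2.integrable one_le_two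
  -- the centred test function φ̄ = φ − µ(φ), |φ̄| ≤ 2, π(φ̄ g) = 0
  set c := b / a with hc
  have hc1 : |c| ≤ 1 := by
    have := abs_targetMean_le_one (π := π) hφ1 hg0 hgint
    unfold targetMean at this
    rw [← ha, ← hb] at this
    exact this
  have hφbar2 : ∀ x, |φ x - c| ≤ 2 := fun x =>
    le_trans (abs_sub _ _) (by linarith [hφ1 x, hc1])
  have hψ2 : MemLp (fun x => (φ x - c) * g x) 2 π := by
    refine (hg2.const_mul 2).of_le ((hφ.sub measurable_const).mul hg).aestronglyMeasurable
      (Filter.Eventually.of_forall fun x => ?_)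
    rw [Real.norm_eq_abs, Real.norm_eq_abs, abs_mul, abs_mul, abs_two]
    exact mul_le_mul_of_nonneg_right (hφbar2 x) (abs_nonneg _)
  have hψint : ∫ x, (φ x - c) * g x ∂π = 0 := by
    have h1 : ∫ x, (φ x - c) * g x ∂π = ∫ x, φ x * g x ∂π - c * ∫ x, g x ∂π := by
      rw [← integral_const_mul, ← integral_sub (integrable_mul hφ hφ1 hgint) (hgint.const_mul c)]
      exact integral_congr_ae (Filter.Eventually.of_forall fun x => by simp only; ring)
    rw [h1, ← ha, ← hb, hc]
    field_simp
    ring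
  -- notation for the two empirical means
  set S := mcMean g N with hS
  set Tc := mcMean (fun x => (φ x - c) * g x) N with hTc
  have hmS := memLp_mcMean (π := π) hg2 N
  have hmTc := memLp_mcMean (π := π) hψ2 N
  have hSint : ∫ u, S u ∂P = a := by rw [hS, integral_mcMean hg2 hN', ha]
  -- E · S = π^N_MC(φg) − c·S = Tc pointwise, and E = Tc / S off the null event
  have hTc_eq : ∀ u, Tc u = mcMean (fun x => φ x * g x) N u - c * S u := by
    intro u
    simp only [hTc, hS, mcMean]
    have hsum : ∑ n, (φ (u n) - c) * g (u n) = ∑ n, φ (u n) * g (u n) - c * ∑ n, g (u n) := by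
      rw [Finset.mul_sum, ← Finset.sum_sub_distrib]
      exact Finset.sum_congr rfl fun n _ => by ring
    rw [hsum]
    ring
  set E := fun u => estimate g φ N u - targetMean π g φ with hE
  have hES : ∀ u, E u * S u = Tc u := by
    intro u
    rw [hTc_eq u]
    show (estimate g φ N u - targetMean π g φ) * S u = mcMean (fun x => φ x * g x) N u - c * S u
    unfold targetMean
    rw [← ha, ← hb, ← hc, estimate_eq_mcMean_div hN', hS]
    by_cases h0 : mcMean g N u = 0
    · have hT0 : mcMean (fun x => φ x * g x) N u = 0 := mcMean_mul_eq_zero hg0 u h0 hN'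
      simp [h0, hT0]
    · field_simp
  -- measurability / integrability of E (bounded by 2)
  have hEmeas : Measurable E := by
    have h1 : Measurable (fun u : Fin N → 𝓧 => estimate g φ N u) := by
      unfold estimate
      refine Measurable.div ?_ ?_
      · exact Finset.measurable_sum _ fun n _ => (hφ.mul hg).comp (measurable_pi_apply n)
      · exact Finset.measurable_sum _ fun n _ => hg.comp (measurable_pi_apply n)
    exact h1.sub measurable_const
  have hEbdd : ∀ u, |E u| ≤ 2 := fun u => abs_estimate_sub_targetMean_le_two hφ1 hg0 hgint u
  have hEint : Integrable E P :=
    (memLp_of_bounded (a := -2) (b := 2)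
      (Filter.Eventually.of_forall fun u => abs_le.mp (hEbdd u)) hEmeas.aestronglyMeasurable 1).integrable le_rfl
  -- Step 1: E[E] = E[Y] with Y = E · (a − S)/a, because E[E·S] = E[Tc] = π(φ̄ g)·… = 0
  have hTcint : ∫ u, Tc u ∂P = 0 := by rw [hTc, integral_mcMean hψ2 hN', hψint]
  have hY : ∫ u, E u ∂P = ∫ u, E u * ((a - S u) / a) ∂P := by
    have h1 : ∀ u, E u * ((a - S u) / a) = E u - (1 / a) * (E u * S u) := by
      intro u
      field_simp
    simp_rw [h1, hES]
    rw [integral_sub hEint ((hmTc.integrable one_le_two).const_mul _), integral_const_mul, hTcint,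
      mul_zero, sub_zero]
  -- Step 2: pointwise |Y| ≤ (2/a²)((a − S)² + Tc²/4) + 2·𝟙{2S ≤ a}
  set A : Set (Fin N → 𝓧) := {u | 2 * S u ≤ a} with hA
  have hAm : MeasurableSet A := by
    rw [hA]
    exact measurableSet_le ((measurable_mcMean hg N).const_mul 2) measurable_const
  have hpt : ∀ u, |E u * ((a - S u) / a)|
      ≤ 2 / a ^ 2 * ((S u - a) ^ 2 + Tc u ^ 2 / 4) + 2 * A.indicator (fun _ => (1 : ℝ)) u := by
    intro u
    have hSnn : 0 ≤ S u := by
      simp only [hS, mcMean]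
      exact mul_nonneg (by positivity) (Finset.sum_nonneg fun n _ => hg0 (u n))
    have hind_nn : 0 ≤ 2 * A.indicator (fun _ => (1 : ℝ)) u :=
      mul_nonneg zero_le_two (Set.indicator_nonneg (fun _ _ => zero_le_one) u)
    have hsq_nn : 0 ≤ 2 / a ^ 2 * ((S u - a) ^ 2 + Tc u ^ 2 / 4) := by positivity
    by_cases hcase : 2 * S u ≤ a
    · -- on A: 0 ≤ (a − S)/a ≤ 1, so |Y| ≤ |E| ≤ 2 = 2·𝟙_A
      have hmem : u ∈ A := hcase
      rw [Set.indicator_of_mem hmem, mul_one]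
      have hfrac : |(a - S u) / a| ≤ 1 := by
        rw [abs_div, abs_of_pos hπg, div_le_one hπg, abs_of_nonneg (by linarith)]
        linarith
      calc |E u * ((a - S u) / a)| = |E u| * |(a - S u) / a| := abs_mul _ _
        _ ≤ 2 * 1 := mul_le_mul (hEbdd u) hfrac (abs_nonneg _) zero_le_two
        _ = 2 := mul_one _
        _ ≤ 2 / a ^ 2 * ((S u - a) ^ 2 + Tc u ^ 2 / 4) + 2 := le_add_of_nonneg_left hsq_nn
    · -- off A: S > a/2 > 0, E = Tc/S, |Y| = |Tc| |a − S| /(a S) ≤ (2/a²)|a − S||Tc| ≤ (2/a²)((a−S)² + Tc²/4)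
      have hcase : a < 2 * S u := not_le.mp hcase
      have hSpos : 0 < S u := by linarith
      have hEeq : E u = Tc u / S u := by
        rw [← hES u, mul_div_assoc, div_self hSpos.ne', mul_one]
      have hnotmem : u ∉ A := fun h => absurd h (not_le.mpr hcase)
      rw [Set.indicator_of_notMem hnotmem, mul_zero, add_zero, hEeq]
      have hY : Tc u / S u * ((a - S u) / a) = Tc u * (a - S u) / (S u * a) := by
        field_simp
      rw [hY, abs_div, abs_mul, abs_of_pos (mul_pos hSpos hπg)]
      -- |Tc||a−S|/(S a) ≤ 2|Tc||a−S|/a² since S > a/2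
      have h1 : |Tc u| * |a - S u| / (S u * a) ≤ 2 * (|Tc u| * |a - S u|) / a ^ 2 := by
        rw [div_le_div_iff₀ (mul_pos hSpos hπg) (by positivity)]
        have hnn : 0 ≤ |Tc u| * |a - S u| := mul_nonneg (abs_nonneg _) (abs_nonneg _)
        have hk : |Tc u| * |a - S u| * a * a ≤ |Tc u| * |a - S u| * a * (2 * S u) :=
          mul_le_mul_of_nonneg_left hcase.le (mul_nonneg hnn hπg.le)
        nlinarith [hk]
      -- AM–GM: 2|x||y| ≤ 2(x² + y²/4) with x = a − S, y = Tc
      have h2 : 2 * (|Tc u| * |a - S u|) ≤ 2 * ((S u - a) ^ 2 + Tc u ^ 2 / 4) := by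
        have := sq_nonneg (|a - S u| - |Tc u| / 2)
        have hx : |a - S u| ^ 2 = (S u - a) ^ 2 := by rw [sq_abs]; ring
        have hy : |Tc u| ^ 2 = Tc u ^ 2 := sq_abs _
        nlinarith [this, hx, hy]
      calc |Tc u| * |a - S u| / (S u * a) ≤ 2 * (|Tc u| * |a - S u|) / a ^ 2 := h1
        _ ≤ 2 * ((S u - a) ^ 2 + Tc u ^ 2 / 4) / a ^ 2 := div_le_div_of_nonneg_right h2 (sq_nonneg _)
        _ = 2 / a ^ 2 * ((S u - a) ^ 2 + Tc u ^ 2 / 4) := by ring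
  -- Step 3: integrate the pointwise bound
  have hiS : Integrable (fun u => (S u - a) ^ 2) P := (hmS.sub (memLp_const a)).integrable_sq
  have hiTc : Integrable (fun u => Tc u ^ 2 / 4) P := hmTc.integrable_sq.div_const 4
  have hiInd : Integrable (fun u => 2 * A.indicator (fun _ => (1 : ℝ)) u) P :=
    ((integrable_const (1 : ℝ)).indicator hAm).const_mul 2
  have hiST : Integrable (fun u => 2 / a ^ 2 * ((S u - a) ^ 2 + Tc u ^ 2 / 4)) P :=
    (hiS.add hiTc).const_mul _
  have hint : Integrable (fun u => 2 / a ^ 2 * ((S u - a) ^ 2 + Tc u ^ 2 / 4)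
      + 2 * A.indicator (fun _ => (1 : ℝ)) u) P := hiST.add hiInd
  have hS2 : ∫ u, (S u - a) ^ 2 ∂P ≤ (∫ x, g x ^ 2 ∂π) / N := by
    rw [hS, ha]
    exact integral_sq_mcMean_sub_le hg2 hN'
  have hTc2 : ∫ u, Tc u ^ 2 ∂P ≤ 4 * (∫ x, g x ^ 2 ∂π) / N := by
    have h1 := integral_sq_mcMean_sub_le (π := π) hψ2 hN'
    rw [hψint] at h1
    simp only [sub_zero] at h1
    rw [← hTc] at h1
    have h2 : ∫ x, ((φ x - c) * g x) ^ 2 ∂π ≤ 4 * ∫ x, g x ^ 2 ∂π := by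
      rw [← integral_const_mul]
      refine integral_mono_of_nonneg (Filter.Eventually.of_forall fun x => sq_nonneg _)
        (hg2.integrable_sq.const_mul 4) (Filter.Eventually.of_forall fun x => ?_)
      simp only
      rw [mul_pow]
      have hφ4 : (φ x - c) ^ 2 ≤ 4 := by
        have := abs_le.mp (hφbar2 x)
        nlinarith [this.1, this.2]
      exact mul_le_mul_of_nonneg_right hφ4 (sq_nonneg _)
    calc ∫ u, Tc u ^ 2 ∂P ≤ (∫ x, ((φ x - c) * g x) ^ 2 ∂π) / N := h1
      _ ≤ (4 * ∫ x, g x ^ 2 ∂π) / N := div_le_div_of_nonneg_right h2 hNpos.le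
      _ = 4 * (∫ x, g x ^ 2 ∂π) / N := by ring
  -- P(2S ≤ a) ≤ P(a/2 ≤ |S − a|) ≤ π(g²)/(N (a/2)²) = 4 π(g²)/(N a²)
  have hPA : P.real A ≤ 4 * (∫ x, g x ^ 2 ∂π) / (N * a ^ 2) := by
    have hsub : A ⊆ {u | a / 2 ≤ |S u - a|} := by
      intro u hu
      have hu' : 2 * S u ≤ a := hu
      show a / 2 ≤ |S u - a|
      rw [abs_sub_comm]
      exact le_trans (by linarith) (le_abs_self (a - S u))
    have hcheb := measureReal_le_abs_mcMean_sub_le (π := π) hg2 hN' (half_pos hπg)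
    rw [← ha, ← hS] at hcheb
    calc P.real A ≤ P.real {u | a / 2 ≤ |S u - a|} := measureReal_mono hsub
      _ ≤ (∫ x, g x ^ 2 ∂π) / (N * (a / 2) ^ 2) := hcheb
      _ = 4 * (∫ x, g x ^ 2 ∂π) / (N * a ^ 2) := by
          field_simp
          ring
  have hindint : ∫ u, A.indicator (fun _ => (1 : ℝ)) u ∂P = P.real A := by
    rw [integral_indicator hAm]
    simp
  calc |∫ u, (estimate g φ N u - targetMean π g φ) ∂P|
      = |∫ u, E u * ((a - S u) / a) ∂P| := by rw [← hY]
    _ ≤ ∫ u, |E u * ((a - S u) / a)| ∂P := abs_integral_le_integral_abs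
    _ ≤ ∫ u, (2 / a ^ 2 * ((S u - a) ^ 2 + Tc u ^ 2 / 4) + 2 * A.indicator (fun _ => (1 : ℝ)) u) ∂P :=
        integral_mono_of_nonneg (Filter.Eventually.of_forall fun u => abs_nonneg _) hint
          (Filter.Eventually.of_forall hpt)
    _ = 2 / a ^ 2 * (∫ u, (S u - a) ^ 2 ∂P + ∫ u, Tc u ^ 2 / 4 ∂P) + 2 * P.real A := by
        rw [integral_add hiST hiInd, integral_const_mul, integral_add hiS hiTc,
          integral_const_mul, hindint]
    _ ≤ 2 / a ^ 2 * ((∫ x, g x ^ 2 ∂π) / N + (4 * (∫ x, g x ^ 2 ∂π) / N) / 4)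
          + 2 * (4 * (∫ x, g x ^ 2 ∂π) / (N * a ^ 2)) := by
        have h4 : ∫ u, Tc u ^ 2 / 4 ∂P ≤ (4 * (∫ x, g x ^ 2 ∂π) / N) / 4 := by
          rw [integral_div]
          exact div_le_div_of_nonneg_right hTc2 (by norm_num)
        gcongr
    _ = 12 / N * rho π g := by
        unfold rho
        rw [← ha]
        field_simp
        ring

end Theorem21

end Autonormalized

end Literature.Probability.ImportanceSampling
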